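import Mathlib.Data.Nat.Choose.Sum
import Literature.Analysis.FluidPDE.CheskidovGluedCalculus
import HarnessLib

/-!
# Fourier–Galerkin for the Euler equations on `T^d`, II: the Leibniz formula for pure iterated
partial derivatives of the convective derivative

Analysis/FluidPDE support file (everything proved; no definitions). Second file of the discharge
of `Torus.eulerSmoothShortTime` (short-time smooth Euler solutions on `T³`, Majda–Bertozzi 2002,
Thm. 3.4, by the `H^m` energy method for the Fourier–Galerkin scheme). The `H^m` energy estimate
(Majda–Bertozzi 2002, Prop. 3.7; Robinson–Rodrigo–Sadowski 2016, §4.1) rests on commuting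
derivatives through the convective term: for smooth `u : T^d → ℝ^d`, `v : T^d → F` and a
coordinate `i`,

  `∂ᵢʲ [(u·∇)v] = ∑_{a ≤ j} (j choose a) ((∂ᵢᵃu)·∇)(∂ᵢ^{j-a} v)`   (`Torus.iterate_partialDeriv_convect`),

the binomial Leibniz formula for the derivation `∂ᵢ` and the "product" `(u, v) ↦ (u·∇)v`
(`∂ᵢ[(u·∇)v] = (∂ᵢu·∇)v + (u·∇)∂ᵢv`, `Torus.partialDeriv_convect_eq_add`, from
`Gluing.partialDeriv_convect` and the symmetry of second partials), proved by induction on `j`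
with Pascal's rule in the form `Finset.sum_choose_succ_nsmul`. The term `a = 0` is `(u·∇)∂ᵢʲv`,
which is the one that cancels in energy estimates (`Torus.integral_inner_convect_eq_zero`); the
terms `a ≥ 1` form the commutator `[∂ᵢʲ, u·∇]v`.

Also: pure iterated partial derivatives of smooth functions are smooth
(`Torus.isSmooth_iterate_partialDeriv`).

## References

* A. J. Majda, A. L. Bertozzi, *Vorticity and Incompressible Flow*, CUP 2002, §3.2.1, Prop. 3.7
  (the `H^m` energy estimate; Leibniz/commutator calculus (3.26)–(3.30)). [`MajdaBertozziCUP2002`]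
-/

noncomputable section

open Set Function
open scoped ContDiff

namespace Literature.Analysis.FluidPDE

namespace Torus

open FunctionSpaces FunctionSpaces.Torus

variable {d : Type*} [Fintype d] [DecidableEq d] {F : Type*} [NormedAddCommGroup F] [NormedSpace ℝ F]

/-- Pure iterated partial derivatives of a smooth function on `T^d` are smooth. [folklore] -/
theorem isSmooth_iterate_partialDeriv {f : UnitAddTorus d → F} (hf : IsSmooth f) (i : d) (j : ℕ) :
    IsSmooth ((partialDeriv i)^[j] f) := by
  induction j with
  | zero => simpa using hf
  | succ j IH =>
    rw [iterate_succ_apply']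
    exact IH.partialDeriv i

/-- **`∂ᵢ[(u·∇)v] = (∂ᵢu·∇)v + (u·∇)(∂ᵢv)`** for smooth `u`, `v` on `T^d`, as functions
(`Gluing.partialDeriv_convect`: `∂ᵢ[(u·∇)v] = ∑ⱼ (∂ᵢuⱼ ∂ⱼv + uⱼ ∂ᵢ∂ⱼv)`, and `∂ᵢ∂ⱼ = ∂ⱼ∂ᵢ`).
[folklore] -/
theorem partialDeriv_convect_eq_add {u : UnitAddTorus d → EuclideanSpace ℝ d} {v : UnitAddTorus d → F}
    (hu : IsSmooth u) (hv : IsSmooth v) (i : d) :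
    partialDeriv i (convect u v) =
      fun x => convect (partialDeriv i u) v x + convect u (partialDeriv i v) x := by
  funext x
  rw [Gluing.partialDeriv_convect hu hv i x, Finset.sum_add_distrib,
    convect_eq_sum_smul_partialDeriv (hv.isContDiff (by simp)),
    convect_eq_sum_smul_partialDeriv ((hv.partialDeriv i).isContDiff (by simp))]
  congr 1
  refine Finset.sum_congr rfl fun j _ => ?_
  rw [partialDeriv_comm hv i j x]

/-- **The binomial Leibniz formula for the convective derivative**: for smooth `u : T^d → ℝ^d`,
`v : T^d → F` and a coordinate `i`,
`∂ᵢʲ [(u·∇)v] = ∑_{a ≤ j} (j choose a) • ((∂ᵢᵃu)·∇)(∂ᵢ^{j-a}v)` (as functions; `•` is the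
natural-number multiple). Induction on `j` with `∂ᵢ[(w·∇)z] = (∂ᵢw·∇)z + (w·∇)∂ᵢz` and Pascal's
rule (`Finset.sum_choose_succ_nsmul`); Majda–Bertozzi 2002, §3.2.1 (the calculus behind the
commutator estimates (3.26)–(3.30) of Prop. 3.7). [cite: MajdaBertozziCUP2002, Prop. 3.7] -/
theorem iterate_partialDeriv_convect {u : UnitAddTorus d → EuclideanSpace ℝ d} {v : UnitAddTorus d → F}
    (hu : IsSmooth u) (hv : IsSmooth v) (i : d) (j : ℕ) :
    (partialDeriv i)^[j] (convect u v) =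
      ∑ a ∈ Finset.range (j + 1),
        (j.choose a) • convect ((partialDeriv i)^[a] u) ((partialDeriv i)^[j - a] v) := by
  induction j with
  | zero =>
    funext x
    simp
  | succ j IH =>
    -- notation for the bilinear terms
    set B : ℕ → ℕ → UnitAddTorus d → F := fun a b =>
      convect ((partialDeriv i)^[a] u) ((partialDeriv i)^[b] v) with hB
    have hBs : ∀ a b, IsSmooth (B a b) := fun a b =>
      (isSmooth_iterate_partialDeriv hu i a).convect (isSmooth_iterate_partialDeriv hv i b)
    have hB1 : ∀ a b, IsContDiff 1 (B a b) := fun a b => (hBs a b).isContDiff (by simp)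
    -- `∂ᵢ (B a b) = B (a+1) b + B a (b+1)`
    have hDB : ∀ a b, partialDeriv i (B a b) = fun x => B (a + 1) b x + B a (b + 1) x := by
      intro a b
      simp only [hB]
      rw [partialDeriv_convect_eq_add (isSmooth_iterate_partialDeriv hu i a)
        (isSmooth_iterate_partialDeriv hv i b), iterate_succ_apply', iterate_succ_apply']
    rw [iterate_succ_apply', IH]
    -- differentiate the sum term by term
    have hsum : partialDeriv i (∑ a ∈ Finset.range (j + 1), (j.choose a) • B a (j - a)) =
        ∑ a ∈ Finset.range (j + 1), (j.choose a) • partialDeriv i (B a (j - a)) := by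
      funext x
      have hterm : ∀ a ∈ Finset.range (j + 1), IsContDiff 1 ((j.choose a) • B a (j - a)) := fun a _ => by
        rw [← Nat.cast_smul_eq_nsmul ℝ]
        exact (hB1 a (j - a)).const_smul ((j.choose a : ℕ) : ℝ)
      have h1 : (∑ a ∈ Finset.range (j + 1), (j.choose a) • B a (j - a)) =
          fun y => ∑ a ∈ Finset.range (j + 1), ((j.choose a) • B a (j - a)) y := by
        funext y; simp [Finset.sum_apply]
      rw [h1, partialDeriv_finset_sum _ hterm i x, Finset.sum_apply]
      refine Finset.sum_congr rfl fun a _ => ?_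
      rw [← Nat.cast_smul_eq_nsmul ℝ, partialDeriv_const_smul (hB1 a (j - a)), Nat.cast_smul_eq_nsmul,
        Pi.smul_apply]
    change partialDeriv i (∑ a ∈ Finset.range (j + 1), (j.choose a) • B a (j - a)) =
      ∑ a ∈ Finset.range (j + 1 + 1), ((j + 1).choose a) • B a (j + 1 - a)
    rw [hsum]
    -- Pascal: `∑_{a<j+2} C(j+1,a) B a (j+1-a) = ∑_{a<j+1} C(j,a) B a (j+1-a) + ∑_{a<j+1} C(j,a) B (a+1) (j-a)`
    rw [show j + 1 + 1 = j + 2 from rfl, Finset.sum_choose_succ_nsmul (fun a b => B a b) j]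
    -- the differentiated sum splits the same way
    have hsplit : ∑ a ∈ Finset.range (j + 1), (j.choose a) • partialDeriv i (B a (j - a)) =
        ∑ a ∈ Finset.range (j + 1), (j.choose a) • B a (j + 1 - a) +
          ∑ a ∈ Finset.range (j + 1), (j.choose a) • B (a + 1) (j - a) := by
      rw [← Finset.sum_add_distrib]
      refine Finset.sum_congr rfl fun a ha => ?_
      have haj : a ≤ j := Nat.lt_succ_iff.1 (Finset.mem_range.1 ha)
      rw [hDB a (j - a), ← smul_add]
      congr 1
      funext x
      rw [Pi.add_apply, add_comm, show j - a + 1 = j + 1 - a by omega]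
    rw [hsplit]

end Torus

end Literature.Analysis.FluidPDE
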